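import Summits.KontsevichZagierPeriods.KontsevichZagierPeriods.Theses.AttractorUnfolding

/-!
# `ResidueKernelGlue` (stmt-KontsevichZagierPeriods-14421, route AttractorUnfolding) — proof

Glue item of route AttractorUnfolding (the item that concludes the route's target):
`TwistProductRep → TwistCancellation → TwistLocalKernel → ResidueKernel`. Pure logic over route
declarations: pin a product `P` (`[π] ⋆ ·`) from `TwistProductRep`; for a formal combination `c`
with `KZ.eval c = 0`, `TwistLocalKernel` gives `N` with `(lift (of ∘ P))^[N] c ∈ KZ.relations`,
and `TwistCancellation` peels the `N` factors `[π]` one at a time (induction on `N`; iterates are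
left-nested, `Function.iterate_succ_apply'`, so no associativity of `⋆` is needed), whence
`c ∈ KZ.relations ≤ KZ.relations ⊔ closure (E1-relators ∪ E2-relators)`
(`AddSubgroup.mem_sup_left`) — which is `ResidueKernel`. The same peeling induction is the
published twin glue `MultiCoVKernel_of_subs` of route MultivaluedCoV
(`Cruxes/MultiCoVKernel/Split.lean`). Planner-proved glue (Sketch.lean of the route-choice repair
planner, 12 tactic lines), landed by lead c10 of crux stmt-KontsevichZagierPeriods-9129 (banking).
No definitions.
-/

namespace Summit.KontsevichZagierPeriods.AttractorUnfolding

open Summit.KontsevichZagierPeriods.KontsevichZagierPeriods.Theses.AttractorUnfolding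

/-- **`ResidueKernelGlue`** (route AttractorUnfolding, stmt-KontsevichZagierPeriods-14421):
`TwistProductRep → TwistCancellation → TwistLocalKernel → ResidueKernel`. Proof: pin `P` from
`TwistProductRep`; given `c` with `KZ.eval c = 0`, take `N` with `(lift (of ∘ P))^[N] c ∈
KZ.relations` from `TwistLocalKernel`, remove the `N` twists one at a time with
`TwistCancellation` (induction on `N`, `Function.iterate_succ_apply'`), so `c ∈ KZ.relations`, and
conclude `c ∈ KZ.relations ⊔ closure (…)` by `AddSubgroup.mem_sup_left`. [folklore] -/
theorem residueKernelGlue_proof :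
    Summit.KontsevichZagierPeriods.KontsevichZagierPeriods.Theses.AttractorUnfolding.ResidueKernelGlue := by
  intro hP hC hL
  -- pin a product `[π] ⋆ ·`
  obtain ⟨P, hP⟩ := hP
  intro c hc
  -- some `[π]^N ⋆ c` is a KZ relation
  obtain ⟨N, hN⟩ := hL P hP c hc
  -- peel the `N` factors `[π]`
  have hrel : c ∈ Literature.NumberTheory.Transcendental.KZ.relations := by
    clear hc
    induction N with
    | zero => simpa using hN
    | succ N ih =>
      exact ih (hC P hP _ (by simpa only [Function.iterate_succ_apply'] using hN))
  exact AddSubgroup.mem_sup_left hrel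

end Summit.KontsevichZagierPeriods.AttractorUnfolding
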